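import Mathlib
import Summits.Ventures.PercRepro2.Graph

/-!
# Connectivity on the `n`-cycle: a vertex reaches another iff one of the two arcs between them is
fully open (blind cell PercRepro2, typer-1 g48)

The `n`-cycle `cycN n` on `V = E = Fin n` has the edge `i = s(i, i + 1)`.  With
`dist u x = (x - u).val` the number of steps from `u` up to `x` and
`upInterval u v = {u, u + 1, …, v - 1}` the edges of the upward arc from `u` to `v`:

* **`conn_of_upInterval`**: if every edge of `[u, v)` is open then `u ↔ v` (walk up the arc);
* **`conn_cycle_iff`**: `u ↔ v` iff the upward arc `[u, v)` or the upward arc `[v, u)` is fully open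
  — the converse is the cut argument: a closed edge `a ∈ [u, v)` and a closed edge `c ∈ [v, u)` leave
  the vertex interval `{a + 1, …, c} ∋ v` closed under open adjacency (`mem_of_conn_of_closed`),
  and `u` is not in it.

Pure combinatorics of `Fin n` (no probability); the base of the cycle theorem (LEAD-CYCLES.md §1).
-/

namespace Summit.Ventures.PercRepro2

namespace Cycle

open Fin.NatCast

variable {n : ℕ} [NeZero n]

/-- The `n`-cycle on `Fin n`: edge `i` joins `i` and `i + 1`. -/
def cycN (n : ℕ) [NeZero n] : Fin n → Sym2 (Fin n) := fun i => s(i, i + 1)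

/-- The edge `i` of the cycle. -/
lemma cycN_apply (i : Fin n) : cycN n i = s(i, i + 1) := rfl

/-! ## Distances along the cycle -/

/-- The number of steps from `u` up to `x`: `u → u + 1 → … → x`. -/
def dist (u x : Fin n) : ℕ := (x - u).val

/-- `u + dist u x = x`. -/
lemma add_dist (u x : Fin n) : u + (dist u x : Fin n) = x := by
  rw [dist, Fin.cast_val_eq_self, add_sub_cancel]

omit [NeZero n] in
/-- A distance is `< n`. -/
lemma dist_lt (u x : Fin n) : dist u x < n := (x - u).isLt

/-- The distance from `u` to `u + k` is `k mod n`. -/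
lemma dist_add_mod (u : Fin n) (k : ℕ) : dist u (u + (k : Fin n)) = k % n := by
  rw [dist, add_sub_cancel_left, Fin.val_natCast]

/-- The distance from `u` to `u + k` is `k` when `k < n`. -/
lemma dist_add (u : Fin n) (k : ℕ) (hk : k < n) : dist u (u + (k : Fin n)) = k := by
  rw [dist_add_mod, Nat.mod_eq_of_lt hk]

/-- `dist u u = 0`. -/
lemma dist_self (u : Fin n) : dist u u = 0 := by
  simp [dist]

/-- Distances from `u` determine the vertex. -/
lemma eq_of_dist_eq {u x y : Fin n} (h : dist u x = dist u y) : x = y := by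
  rw [← add_dist u x, ← add_dist u y, h]

/-- Distance `0` means equality. -/
lemma eq_of_dist_eq_zero {u x : Fin n} (h : dist u x = 0) : x = u := by
  rw [← add_dist u x, h, Nat.cast_zero, add_zero]

/-- One step up adds one to the distance, modulo `n`. -/
lemma dist_succ_mod (u x : Fin n) : dist u (x + 1) = (dist u x + 1) % n := by
  conv_lhs => rw [← add_dist u x]
  rw [add_assoc, ← Nat.cast_succ, dist_add_mod]

/-- One step up adds one to the distance when there is no wrap-around. -/
lemma dist_succ (u x : Fin n) (h : dist u x + 1 < n) : dist u (x + 1) = dist u x + 1 := by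
  rw [dist_succ_mod, Nat.mod_eq_of_lt h]

/-- Casts subtract when the difference is a natural number. -/
lemma natCast_sub_natCast (k m : ℕ) (hmk : m ≤ k) :
    (k : Fin n) - (m : Fin n) = ((k - m : ℕ) : Fin n) := by
  rw [sub_eq_iff_eq_add, ← Nat.cast_add, Nat.sub_add_cancel hmk]

/-- `dist (u + k) (u + m) = m - k` for `k ≤ m < n`. -/
lemma dist_add_add (u : Fin n) (k m : ℕ) (hkm : k ≤ m) (hm : m < n) :
    dist (u + (k : Fin n)) (u + (m : Fin n)) = m - k := by
  rw [dist, add_sub_add_left_eq_sub, natCast_sub_natCast m k hkm]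
  exact Fin.val_cast_of_lt (by omega)

/-- `dist (u + k) (u + m) = n - (k - m)` for `m < k < n` (wrap-around). -/
lemma dist_add_add' (u : Fin n) (k m : ℕ) (hmk : m < k) (hk : k < n) :
    dist (u + (k : Fin n)) (u + (m : Fin n)) = n - (k - m) := by
  rw [dist, add_sub_add_left_eq_sub, ← neg_sub, natCast_sub_natCast k m hmk.le, Fin.val_neg]
  have h1 : ((k - m : ℕ) : Fin n).val = k - m := Fin.val_cast_of_lt (by omega)
  have h2 : ((k - m : ℕ) : Fin n) ≠ 0 := by
    intro h
    rw [h, Fin.val_zero] at h1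
    omega
  rw [if_neg h2, h1]

/-- The two arcs between distinct vertices have total length `n`. -/
lemma dist_add_dist (u v : Fin n) (huv : u ≠ v) : dist u v + dist v u = n := by
  have h : v - u ≠ 0 := sub_ne_zero.2 (Ne.symm huv)
  rw [dist, dist, ← neg_sub v u, Fin.val_neg, if_neg h]
  have := (v - u).isLt
  omega

/-! ## The upward arc -/

/-- The edges `u, u + 1, …, v - 1` of the upward arc from `u` to `v` (empty when `u = v`). -/
def upInterval (u v : Fin n) : Finset (Fin n) :=
  Finset.univ.filter fun i => dist u i < dist u v

omit [NeZero n] in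
/-- Membership in the upward arc. -/
lemma mem_upInterval {u v i : Fin n} : i ∈ upInterval u v ↔ dist u i < dist u v := by
  simp [upInterval]

/-! ## Walking up an open arc -/

/-- `t` open edges `u, u + 1, …, u + t - 1` connect `u` to `u + t`. -/
lemma conn_add_of_forall (ω : Config (Fin n)) (u : Fin n) (t : ℕ)
    (h : ∀ s < t, ω (u + (s : Fin n)) = true) : Conn (cycN n) ω u (u + (t : Fin n)) := by
  induction t with
  | zero =>
    rw [Nat.cast_zero, add_zero]
    exact conn_refl _ _ _
  | succ t ih =>
    have h1 := ih (fun s hs => h s (Nat.lt_succ_of_lt hs))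
    have h2 : OpenAdj (cycN n) ω (u + (t : Fin n)) (u + ((t + 1 : ℕ) : Fin n)) :=
      ⟨u + (t : Fin n), h t (Nat.lt_succ_self t), by rw [cycN_apply, Nat.cast_succ, add_assoc]⟩
    exact conn_trans h1 (conn_of_openAdj h2)

/-- **If every edge of the upward arc `[u, v)` is open then `u ↔ v`.** -/
theorem conn_of_upInterval (ω : Config (Fin n)) (u v : Fin n)
    (h : ∀ i ∈ upInterval u v, ω i = true) : Conn (cycN n) ω u v := by
  rw [← add_dist u v]
  apply conn_add_of_forall
  intro s hs
  apply h
  rw [mem_upInterval, dist_add u s (lt_trans hs (dist_lt u v))]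
  exact hs

/-! ## The cut argument -/

/-- With the edges `a` and `c` closed, the vertex interval `{a + 1, …, c}` is closed under open
adjacency. -/
lemma closed_under_openAdj (ω : Config (Fin n)) {a c : Fin n} (ha : ω a = false)
    (hc : ω c = false) {x y : Fin n} (hx : dist (a + 1) x ≤ dist (a + 1) c)
    (hxy : (openGraph (cycN n) ω).Adj x y) : dist (a + 1) y ≤ dist (a + 1) c := by
  rw [openGraph_adj] at hxy
  obtain ⟨_, e, he, hends⟩ := hxy
  rw [cycN_apply, Sym2.eq_iff] at hends
  rcases hends with ⟨rfl, rfl⟩ | ⟨rfl, rfl⟩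
  · -- `x = e`, `y = e + 1`: `e ≠ c` since `e` is open, so `dist (a+1) e < dist (a+1) c`
    have hne : dist (a + 1) e ≠ dist (a + 1) c := by
      intro h
      rw [eq_of_dist_eq h, hc] at he
      exact Bool.false_ne_true he
    have hlt : dist (a + 1) e < dist (a + 1) c := lt_of_le_of_ne hx hne
    rw [dist_succ _ _ (lt_of_le_of_lt hlt (dist_lt _ _))]
    exact hlt
  · -- `x = e + 1`, `y = e`: `e ≠ a` since `e` is open, so `e + 1 ≠ a + 1` and the distance drops
    rw [dist_succ_mod] at hx
    rcases Nat.lt_or_ge (dist (a + 1) e + 1) n with h1 | h1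
    · rw [Nat.mod_eq_of_lt h1] at hx
      omega
    · have h2 : dist (a + 1) e + 1 = n := le_antisymm (dist_lt _ _) h1
      rw [h2, Nat.mod_self] at hx
      -- then `dist (a+1) (e+1) = 0`, i.e. `e + 1 = a + 1`, i.e. `e = a`, which is closed
      exfalso
      have h3 : dist (a + 1) (e + 1) = 0 := by
        rw [dist_succ_mod, h2, Nat.mod_self]
      have h4 : e = a := add_right_cancel (eq_of_dist_eq_zero h3)
      rw [h4, ha] at he
      exact Bool.false_ne_true he

/-- **Connectivity on the cycle**: `u ↔ v` iff the upward arc `[u, v)` or the upward arc `[v, u)`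
is fully open. -/
theorem conn_cycle_iff (ω : Config (Fin n)) (u v : Fin n) :
    Conn (cycN n) ω u v ↔
      (∀ i ∈ upInterval u v, ω i = true) ∨ (∀ i ∈ upInterval v u, ω i = true) := by
  constructor
  · intro hconn
    by_cases h1 : ∀ i ∈ upInterval u v, ω i = true
    · exact Or.inl h1
    by_cases h2 : ∀ i ∈ upInterval v u, ω i = true
    · exact Or.inr h2
    exfalso
    obtain ⟨a, ha⟩ := not_forall.1 h1
    obtain ⟨ha, ha'⟩ := Classical.not_imp.1 ha
    obtain ⟨c, hc⟩ := not_forall.1 h2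
    obtain ⟨hc, hc'⟩ := Classical.not_imp.1 hc
    rw [mem_upInterval] at ha hc
    have ha' : ω a = false := by simpa using ha'
    have hc' : ω c = false := by simpa using hc'
    -- `u ≠ v`: the arc `[u, v)` contains an edge
    have huv : u ≠ v := by
      rintro rfl
      rw [dist_self] at ha
      exact Nat.not_lt_zero _ ha
    -- distances from `u`
    set D := dist u v with hD
    set da := dist u a with hda
    set dc := dist v c with hdc
    have hDn : D < n := dist_lt u v
    have hsum : D + dist v u = n := dist_add_dist u v huv
    have hcn : D + dc < n := by omega
    have hav : a = u + (da : Fin n) := (add_dist u a).symm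
    have hvv : v = u + (D : Fin n) := (add_dist u v).symm
    have hcv : c = u + ((D + dc : ℕ) : Fin n) := by
      rw [Nat.cast_add, ← add_assoc, ← hvv]
      exact (add_dist v c).symm
    have ha1 : a + 1 = u + ((da + 1 : ℕ) : Fin n) := by
      rw [hav, Nat.cast_succ, add_assoc]
    -- the closed vertex interval `S = {a + 1, …, c}` contains `v` and not `u`
    have hcS : dist (a + 1) c = D + dc - (da + 1) := by
      rw [ha1, hcv, dist_add_add u (da + 1) (D + dc) (by omega) hcn]
    have hvS : dist (a + 1) v ≤ dist (a + 1) c := by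
      rw [hcS, ha1, hvv, dist_add_add u (da + 1) D (by omega) hDn]
      omega
    have hu0 : dist (a + 1) u = n - (da + 1) := by
      have h0 : dist (a + 1) u = dist (u + ((da + 1 : ℕ) : Fin n)) (u + ((0 : ℕ) : Fin n)) := by
        rw [ha1, Nat.cast_zero, add_zero]
      rw [h0, dist_add_add' u (da + 1) 0 (by omega) (by omega), Nat.sub_zero]
    have huS : ¬ dist (a + 1) u ≤ dist (a + 1) c := by
      rw [hu0, hcS]
      omega
    exact huS (mem_of_conn_of_closed (S := {w | dist (a + 1) w ≤ dist (a + 1) c})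
      (fun x hx y hxy => closed_under_openAdj ω ha' hc' hx hxy) hvS (conn_symm hconn))
  · rintro (h | h)
    · exact conn_of_upInterval ω u v h
    · exact conn_symm (conn_of_upInterval ω v u h)

end Cycle

end Summit.Ventures.PercRepro2
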